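import Mathlib
import Summits.Ventures.HodgeRepro.Tier4.Common.LocalTorusCompactConj
import Summits.Ventures.HodgeRepro.Tier4.Common.TestProjectorVanishing
import Summits.Ventures.HodgeRepro.Tier4.Common.CompactHaarProbability
import Summits.Ventures.HodgeRepro.Tier4.Common.RowTorus
import Summits.Ventures.HodgeRepro.Tier4.Common.RowWeights
import Summits.Ventures.HodgeRepro.Tier4.Common.LocalTorusCompact
import Summits.Ventures.HodgeRepro.Tier4.Line4.ProjPlane
import Summits.Ventures.HodgeRepro.Tier4.Line4.ProjDataSeesaw
import Summits.Ventures.HodgeRepro.Tier4.Line4.KTypeOfPeriodRow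
import Summits.Ventures.HodgeRepro.Tier4.Line4.KTypeOfPeriodSeesaw
import Summits.Ventures.HodgeRepro.Tier4.Line4.L1ClassWall

/-!
# Tier4/Line4/KTypeDataSeesaw — C-L4-KTYPEDATA-SEESAW: the `KTypeData` display of the v0.33 assembly on the wall's plane,
every field a theorem

Blind re-derivation cell `pub-hodge-repro`, Tier 4 «prove the step» (README §9–§10), seat t4-L4-p1 (prover, LINE L4,
gen 4; plan-4 g4's cut S14857 (d)).  Tree path `lean/Summits/Ventures/HodgeRepro/Tier4/Line4/KTypeDataSeesaw.lean`.
Mathlib-level; no literature.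

WHAT IS PROVED.  `kTypeData_seesaw : KTypeData (seesawOf q a g g' hgg' hg'g hgΩ) R q g g' eP eM eP' eM'` — the bundle
of technical inputs of KTYPE (4)/(6) that `L1Class.wall_of_L1_data` displays as `D`, on L4-p2's `seesawOf` (= the
skeleton's `seesawPlane`), with every field bound by name:
* `rightT` / `rightT'` — the tori `T`, `T′` of the seesaw plane are commutative (`torusT_ofLinesRow_comm` through the
  definitional transport, `torusT'_seesaw_comm` of KTypeOfPeriodSeesaw), so left-invariant measures are right-invariant
  (`isMulRightInvariant_torusT_seesaw`, `isMulRightInvariant_torusT'_seesaw`);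
* `compactT` / `compactT'` — the local tori at every real CM place are compact (typer-2's
  `compactSpace_localTorusAt_ofLinesRow`, transported, and `compactSpace_localTorusAt'_seesaw` under the similitude);
* `measT` / `measT'` — Haar probability measures on them (`haarProb`, CompactHaarProbability);
* `mulT` / `contT` / `unitT` — the `T`-weight character is multiplicative, continuous and unitary on the local tori
  (RowWeights' `weightChar_localTorusAt_mul` / `norm_weightChar_localTorusAt_eq_one`, KTypeOfPeriodRow's
  `continuous_weightChar_localTorusAt`, transported);
* `mulT'` / `contT'` / `unitT'` — the transported `T′`-weight character likewise (`weightChar'_mul_of_conj` /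
  `norm_weightChar'_eq_one_of_conj` on `localTorusAt'_withTransportedTorus_conj`, L4-p2's
  `continuous_weightChar'_localTorusAt'`);
* `matchT` / `matchT'` — the wall's own `_hchi` / `_hchi'`.
BINDERS (the wall's, v0.30 `mixed_two_torus_W3`, plus two): `a i ≠ 0` (`_ha`), the similitude `lam ≠ 0`, `hiso`
(`_hlam`, `_hiso`), `_hchi`, `_hchi'`; NEW relative to v0.30 — `hreal : ∀ w, w.IsReal` and `hcm : ∀ w, IsCMAt q w` (every
infinite place of `k` real with the CM inequality — the compactness of the local tori and the weight laws are proved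
under them, as in L4-p2's `hnorm_seesaw`; whether `DescribesCM q` supplies them is the planner's call).

Nothing here says anything about the status of the Hodge conjecture for CM abelian varieties, which is NOT proved
(HC_CM is NOT proved by anyone in this repository).
-/

set_option autoImplicit false

noncomputable section

namespace Summit.Ventures.HodgeRepro.Tier4.Line4

open Summit.Ventures.HodgeRepro.Tier4.Common Summit.Ventures.HodgeRepro.Tier4.Line1 MeasureTheory NumberField Matrix
open scoped ComplexConjugate

section KTypeData

variable {k : Type} [Field k] [NumberField k] (q : QuadData k) (a : Fin 4 → k)
  (g g' : Matrix (Fin 4) (Fin 4) k) (hgg' : g * g' = 1) (hg'g : g' * g = 1)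
  (hgΩ : g * (PlaneData.mixedRow q (a 0) (a 2)).Ω = (PlaneData.mixedRow q (a 0) (a 2)).Ω * g)

/-- **The torus `T` of the seesaw plane is commutative** (it is the torus of the row plane `mixedRow q a₀ a₂`:
`withTransportedTorus` keeps `P`; `torusT_ofLinesRow_comm` through the definitional transport). -/
theorem torusT_seesaw_comm (ha0 : a 0 ≠ 0) (ha2 : a 2 ≠ 0) (s t : GA (seesawOf q a g g' hgg' hg'g hgΩ))
    (hs : s ∈ torusT (seesawOf q a g g' hgg' hg'g hgΩ)) (ht : t ∈ torusT (seesawOf q a g g' hgg' hg'g hgΩ)) :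
    s * t = t * s :=
  torusT_ofLinesRow_comm q (a 0) (a 2) (-1) ha0 ha2 (neg_ne_zero.2 one_ne_zero) s t hs ht

/-- **A left-invariant measure on the torus `T` of the seesaw plane is right-invariant.** -/
theorem isMulRightInvariant_torusT_seesaw (ha0 : a 0 ≠ 0) (ha2 : a 2 ≠ 0)
    [MeasurableSpace (torusT (seesawOf q a g g' hgg' hg'g hgΩ))]
    (μT : Measure (torusT (seesawOf q a g g' hgg' hg'g hgΩ))) [μT.IsMulLeftInvariant] : μT.IsMulRightInvariant :=
  isMulRightInvariant_of_forall_comm μT fun s t =>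
    Subtype.ext (torusT_seesaw_comm q a g g' hgg' hg'g hgΩ ha0 ha2 s.1 t.1 s.2 t.2)

/-- **The local torus of `T` at a real CM place is compact** on the seesaw plane (typer-2's
`compactSpace_localTorusAt_ofLinesRow`, transported). -/
theorem compactSpace_localTorusAt_seesaw (ha0 : a 0 ≠ 0) (ha2 : a 2 ≠ 0) {w : InfinitePlace k} (hw : w.IsReal)
    (hcm : IsCMAt q w) : CompactSpace (localTorusAt (seesawOf q a g g' hgg' hg'g hgΩ) w) :=
  compactSpace_localTorusAt_ofLinesRow q (a 0) (a 2) (-1) ha0 ha2 (neg_ne_zero.2 one_ne_zero) hw hcm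

variable [MeasurableSpace (GA (seesawOf q a g g' hgg' hg'g hgΩ))] [BorelSpace (GA (seesawOf q a g g' hgg' hg'g hgΩ))]
  (R : RTFData (seesawOf q a g g' hgg' hg'g hgΩ)) [R.μT.IsHaarMeasure] [R.μT'.IsHaarMeasure]

/-- **C-L4-KTYPEDATA-SEESAW**: the `KTypeData` display of `L1Class.wall_of_L1_data` on the wall's plane, from the wall's
binders (`a i ≠ 0`, the similitude, `_hchi`, `_hchi'`) and the real CM places (`hreal`, `hcm`). -/
theorem kTypeData_seesaw (ha : ∀ i, a i ≠ 0) (lam : k) (hlam : lam ≠ 0)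
    (hiso : g * (PlaneData.mixedRow q (a 1) (a 3)).B * gᵀ = lam • (PlaneData.mixedRow q (a 0) (a 2)).B)
    (hreal : ∀ w : InfinitePlace k, w.IsReal) (hcm : ∀ w : InfinitePlace k, IsCMAt q w)
    (eP eM eP' eM' : InfinitePlace k → ℤ)
    (hchi : ∀ w, ChiMatchesAt (seesawOf q a g g' hgg' hg'g hgΩ) q w (eP w) (eM w) R.chi)
    (hchi' : ∀ w, ChiMatchesAt' (seesawOf q a g g' hgg' hg'g hgΩ) q w g g' (eP' w) (eM' w) R.chi') :
    L1Class.KTypeData (seesawOf q a g g' hgg' hg'g hgΩ) R q g g' eP eM eP' eM' where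
  rightT := isMulRightInvariant_torusT_seesaw q a g g' hgg' hg'g hgΩ (ha 0) (ha 2) R.μT
  rightT' := isMulRightInvariant_torusT'_seesaw q a g g' hgg' hg'g hgΩ lam hlam hiso (ha 1) (ha 3) R.μT'
  compactT := fun w => compactSpace_localTorusAt_seesaw q a g g' hgg' hg'g hgΩ (ha 0) (ha 2) (hreal w) (hcm w)
  compactT' := fun w =>
    compactSpace_localTorusAt'_seesaw q a g g' hgg' hg'g hgΩ lam hlam hiso (ha 1) (ha 3) (hreal w) (hcm w)
  measT := fun w => by
    haveI := compactSpace_localTorusAt_seesaw q a g g' hgg' hg'g hgΩ (ha 0) (ha 2) (hreal w) (hcm w)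
    exact ⟨haarProb (localTorusAt (seesawOf q a g g' hgg' hg'g hgΩ) w), isHaarMeasure_haarProb _,
      isProbabilityMeasure_haarProb _⟩
  measT' := fun w => by
    haveI := compactSpace_localTorusAt'_seesaw q a g g' hgg' hg'g hgΩ lam hlam hiso (ha 1) (ha 3) (hreal w) (hcm w)
    exact ⟨haarProb (localTorusAt' (seesawOf q a g g' hgg' hg'g hgΩ) w), isHaarMeasure_haarProb _,
      isProbabilityMeasure_haarProb _⟩
  mulT := fun w =>
    weightChar_localTorusAt_mul q (a 0) (a 2) (-1) w (ha 0) (ha 2) (neg_ne_zero.2 one_ne_zero) (hreal w) (hcm w)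
      (eP w) (eM w) w
  contT := fun w =>
    continuous_weightChar_localTorusAt q (a 0) (a 2) (-1) (ha 0) (ha 2) (neg_ne_zero.2 one_ne_zero) (hreal w) (hcm w)
      (eP w) (eM w)
  unitT := fun w κ =>
    norm_weightChar_localTorusAt_eq_one q (a 0) (a 2) (-1) w (ha 0) (ha 2) (neg_ne_zero.2 one_ne_zero) (hreal w)
      (hcm w) (eP w) (eM w) w κ.1 κ.2
  matchT := hchi
  mulT' := fun w =>
    weightChar'_mul_of_conj q (a 1) (a 3) (-1) w (ha 1) (ha 3) (neg_ne_zero.2 one_ne_zero) (hreal w) (hcm w) _ g g'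
      (adMat_mul_adMat_eq_one g g' hgg') w
      (localTorusAt'_withTransportedTorus_conj q a g g' hgg' hg'g hgΩ lam hlam hiso w) (eP' w) (eM' w)
  contT' := fun w =>
    continuous_weightChar'_localTorusAt' _ q g g' eP' eM' w fun κ hκ j =>
      norm_weightAt'_eq_one_of_conj q (a 1) (a 3) (-1) w (ha 1) (ha 3) (neg_ne_zero.2 one_ne_zero) (hreal w) (hcm w) _
        g g' w (localTorusAt'_withTransportedTorus_conj q a g g' hgg' hg'g hgΩ lam hlam hiso w) j κ hκ
  unitT' := fun w κ =>
    norm_weightChar'_eq_one_of_conj q (a 1) (a 3) (-1) w (ha 1) (ha 3) (neg_ne_zero.2 one_ne_zero) (hreal w) (hcm w) _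
      g g' w (localTorusAt'_withTransportedTorus_conj q a g g' hgg' hg'g hgΩ lam hlam hiso w) (eP' w) (eM' w) κ κ.2
  matchT' := hchi'

end KTypeData

end Summit.Ventures.HodgeRepro.Tier4.Line4

end
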